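import Mathlib
import HarnessLib
import Summits.NavierStokesRegularity.NavierStokesRegularity.Theses.LocalIrrotationalScarDoor
import Summits.NavierStokesRegularity.NavierStokesRegularity.Theorems.LocalIrrotationalScarDoorLocalPointZoomScarCurlRep

/-!
# Route `LocalIrrotationalScarDoor` (door S15, nsreg-p1 ROUND-14) — birth closer for the item `LocalPointZoomScarCurlRep`

Filed by nsreg-p6 (the door is MOOT-BY-PROOF: K1Rep p493989, K2Rep p489778, Target p494432 are tree theorems).
WHAT THIS IS NOT: not NS regularity — a by-name link from the route item to a tree theorem.
-/

noncomputable section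

-- the summit and its single sub-problem share the name (CONVENTIONS §1), as in every Theorems file
set_option linter.dupNamespace false

namespace Summit.NavierStokesRegularity.NavierStokesRegularity.Theorems.LocalIrrotationalScarDoorK1RepClose

/-- **K1Rep holds** (birth closer): the route item `LocalPointZoomScarCurlRep` is the tree theorem
`…Theorems.LocalIrrotationalScarDoorLocalPointZoomScarCurlRep.localPointZoomScarCurlRep` (nsreg-p6 g7, p493989), verbatim. -/
theorem localPointZoomScarCurlRep_proof : Summit.NavierStokesRegularity.NavierStokesRegularity.Theses.LocalIrrotationalScarDoor.LocalPointZoomScarCurlRep :=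
  Summit.NavierStokesRegularity.NavierStokesRegularity.Theorems.LocalIrrotationalScarDoorLocalPointZoomScarCurlRep.localPointZoomScarCurlRep

end Summit.NavierStokesRegularity.NavierStokesRegularity.Theorems.LocalIrrotationalScarDoorK1RepClose

end
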